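import Mathlib
import HarnessLib
import HarnessLib.Audit
import Summits.Langlands.Statement
import Literature.NumberTheory.Automorphic.StrongArtinGL2
import Literature.NumberTheory.Automorphic.SerreConjecture

/-!
Route: PSL2ArtinDoor

CLOSED (retired) 2026-08-15T13:48:43Z by operator:999:1257524 — reason: not-a-thesis: assembly does not conclude the sub-problem Statement — note: D-0027 §2.1 audit (human 2026-08-15: routes that do not decide the summit are removed): the assembly concludes `KleinStrongArtin`, not the sub-problem statement; a NEW conforming route may be opened from the same idea (generated `closes : … → _root_.Langlands`).. The file is kept as the record of this route; refuted decls are indexed as negative knowledge (`ledger negatives`).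

THESIS X (it suffices to show X) — route PSL2ArtinDoor, realising idea card
Langlands/Langlands/psl2q-artin-door-rank3 ("each simple Hessian group brings its own prime").
Sector of conjunct (B) `Summit.Langlands.GaloisToAutomorphic` at n = 3, F = ℚ, Hodge–Tate weights
(0,0,0) (finite image), INSOLUBLE image: by Blichfeldt the primitive insoluble finite subgroups of
PGL₃(ℂ) are PSL₂(𝔽_q), q ∈ {5,7,9}; this route treats the Klein group PSL₂(7) ≅ GL₃(𝔽₂) at its own
prime p = 7 (Valentiner 3.A₆ at p = 3 enters as a support door only).
X in words: every continuous σ : Γ_ℚ → GL₃(ℂ) whose image is the simple group of order 168 and under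
which complex conjugation acts non-trivially (the PSL₂(7)-field is not totally real) is automorphic:
there is a cuspidal automorphic representation π of GL₃(𝔸_ℚ) with t_{π,v} ∼ σ(Frob_v) for almost all
v (the tree's `IsPiOfArtinRep`, exactly the idiom of the accepted strong-Artin library
`Literature.NumberTheory.Automorphic.strongArtin_of_isOctahedralType`).
X in Lean (decl `KleinStrongArtin`, elaborates, folder Sketch.lean rc 0): ∀ σ : FramedArtinRep ℚ 3,
Nonempty (σ.range ≃* GL (Fin 3) (ZMod 2)) → (∃ c, IsComplexConjugation (Rat.castHom ℝ) c ∧ σ c ≠ 1)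
→ ∃ hcpt (π : CuspidalAutomorphicRepData 3 ℚ hcpt), IsPiOfArtinRep σ π.1.
TWO-LAYER PLAN. Layer 1 (filed now, typed): crux ArtinWeightLifting (rank 2: automorphy of a
Klein-image σ whose mod-7 reduction is absolutely irreducible and equal to Ad⁰(ρ̄_f) for a newform f
of weight ≥ 2 — the consequence form of the card's α ∧ β), crux ResidualSymSquareDoor (rank 3:
Khare–Wintenberger at p = 7 ⇒ that residual hypothesis holds for EVERY Klein-image odd-type σ, via
Tate's lift of Γ_ℚ → PSL₂(𝔽₇) ⊂ PGL₂(𝔽̄₇), oddness from c ↦ involution, and the 7-modular Brauer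
table of PSL₂(7): both degree-3 characters reduce to the adjoint module L(2)), and the Assembly KW₇
→ Door → Lifting → X (modus ponens, checked in Sketch.lean). Layer 2 (glue later, tenure):
ArtinWeightLifting splits into α = big R = T_𝔪 on completed cohomology of GL₃/ℚ at 𝔪 = 𝔪(Sym² f) in
defect l₀ = 1 with H¹(PSL₂(𝔽₇), ad⁰) ≠ 0 (a forced bad Taylor–Wiles prime) and β = classicality of a
de Rham point of T_𝔪 at weight (0,0,0), once the completed-cohomology interface (definition request
filed) lands; general projective-Klein σ and the transfer to all places ride on the support items.
RELATION TO THE SUMMIT: X is a proper sub-family of instances of conjunct (B) for (n, F) = (3, ℚ)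
(finite-image ρ = ι⁻¹σ are de Rham of weight 0 and unramified a.e.); it does not imply `Langlands`.
The upgrade from a.e. Satake matching (`IsPiOfArtinRep`) to `Summit.Langlands.Corresponds` at every
place is the generic local–global step shared by every (B)-instance and is deliberately not an item
of this route.

UNDER FLOOR: fewer than 2 cruxes remain after retriage (legacy route; D-0019).

Rationale: WHY THIS LINE. Direction (B) for insoluble rank-3 Artin representations over ℚ is untouched by every
existing engine: no solvable tower (simple image;
Literature.Barriers.Langlands.SolvableImageBarrier), no Shimura host for GL₃/ℚ, no unitary descent
(the degree-3 characters of PSL₂(7) are complex conjugate, σ ≇ σ^∨ ⊗ χ; TwistedEndoscopySelfDual),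
no converse theorem without Artin holomorphy. The card's observation: the obstruction IS the
residual modular form — PSL₂(7) reduces mod 7 to itself, a Tate lift of Γ_ℚ → PSL₂(𝔽₇) ⊂ PGL₂(𝔽̄₇)
is ODD as soon as c ↦ involution, Khare–Wintenberger [KhareWintenberger2009] makes it ρ̄_f, and the
unique 3-dimensional 7-modular irreducible of PSL₂(7) is Ad⁰, so σ̄ ≅ Ad⁰(ρ̄_f) = residual Sym² f ⊗
ω_f⁻¹: residual automorphy in REGULAR weight (Gelbart–Jacquet [GelbartJacquet1978], tree fact
`GelbartJacquet_adjoint_lift`) for free — the rank-3 insoluble analogue of "weight one is congruent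
to weight p". Imported areas: modular representation theory of finite groups of Lie type (Brauer
tables, Cline–Parshall–Scott H¹) + completed-cohomology automorphy lifting (Calegari–Geraghty
[CalegariGeraghty2017], Gee–Newton arXiv:1609.06965, Hansen arXiv:1412.1533, [Scholze2015],
[Pan2022], arXiv:2605.03519). Catalogue: a congruence/deformation line; no
spectral/probabilistic/physical reformulation is used (none offers a residual foothold here).
RANKED CRUXES. (2) ArtinWeightLifting — hardest and most informative: automorphy lifting at Artin
weight on GL₃/ℚ from the Sym² residual locus; as a STATEMENT it is a special case of strong Artin
(cannot be false unless (B) is), as a PROOF it needs positive-defect patching with a non-adequate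
residual image (H¹(PSL₂(𝔽₇), Sym⁴) ≠ 0) and a weight-(0,0,0) classicality. (3) ResidualSymSquareDoor
— theorem-sized modulo named facts (KW strong form `khare_wintenberger 7 k`, in tree; Tate lifting
and the 7-modular Brauer table of PSL₂(7), cite items filed); why it might fail as typed: the
reduction/oddness bookkeeping (c non-central ⇒ lift odd), `2 ≤ w` (Serre weight ≥ 2, tree theorem
two_le_serreWeightLocal_of_charZero), constructing `LocalRestrictionAt 7` for ℚ₇. Support:
ModSevenReductionExists (Serre: stable lattices, finite image), KleinTypeTwistReduction
(projective-Klein σ = ψ ⊗ σ₀ with image(σ₀) ≅ PSL₂(7): [Γ,Γ] is a perfect central extension of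
PSL₂(7) with a faithful 3-dimensional representation, hence PSL₂(7) itself), TwistTransfer (π ↦ π ⊗
(ψ∘Art)), ValentinerResidualDoor (the p = 3 door for image 3.A₆, entry point of the sibling line),
BadTWPrimeKlein (informal diagnosis, GAP-certifiable).
KILL CRITERIA. (i) A refutation of ResidualSymSquareDoor (e.g. the Brauer identity or the parity
step fails for some Klein field) closes the route — cheapest check: the 7-modular decomposition
matrix of PSL₂(7) (ten minutes in GAP) and one worked example (Trinks field x⁷ − 7x + 3: predicted
Sym² f mod 7, trace congruences for p ≤ 200). (ii) A theorem that big R = T_𝔪 in positive defect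
FAILS when H¹(im ρ̄, ad⁰) ≠ 0 (not merely that proofs need adequacy) retires crux (2)'s intended
split and sends the line dormant. (iii) Evidence that no non-Sym² GL₃ eigensystem mod 7^m through σ
exists at any level (Ash–Doud–Pollack-type computation, arXiv:math/0102233 §7.2) would contradict
(B) itself and is recorded, not expected.
NOT DECOMPOSED YET (by design, D-0019): the split of ArtinWeightLifting into α (big R = T_𝔪, defect
1, H¹-tolerant Taylor–Wiles primes à la [Thorne2016] / derived patching) and β (archimedean
classicality at weight (0,0,0), shared with cards even-artin-gl4-door, bianchi-artin-points,
fontaine-operator-order-zero) — waits for the completed-cohomology-of-GL_n/ℚ interface (definition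
item); the Valentiner lifting at p = 3 = n (outside Fontaine–Laffaille and every adequacy range) —
only its residual door is filed; the (p−1)-dimensional cuspidal family of the card (GL₆ for PSL₂(7))
— same two cruxes, later; the all-places upgrade IsPiOfArtinRep ⇒ Corresponds (generic).
PRIOR-PROGRAMME NOTES: not read (plancard mode; docs/m5/inspiration untouched).

Novelty: Nearest prior art (searched by the card author and READ by
refuter-novelty-audit-Langlands-Langlands-6-0, grade new-combination; my re-search 2026-08-15: lit
frontier Langlands --since 2021 (30 rows; relevant context only: arXiv:2605.03519 infinitesimal
characters of completed cohomology of GL_n/CM, arXiv:2502.10799 images of automorphic Galois reps),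
lit galaxy search "simple group of order 168" / "three-dimensional Artin representation" --star all
(0 relevant), zbMATH "three-dimensional Galois representations PSL(2,7) automorphic" (0);
OpenAlex/S2/arXiv rate-limited at filing, noted): arXiv:math/0102233 =
doi:10.1215/s0012-9074-02-11235-6 (Ash–Doud–Pollack, Duke 112 (2002) §7.2: PSL₂(7)-extensions
realised in GL₃ cohomology over 𝔽₁₁, ℓ ∤ |G| — residual EVIDENCE, not the p = 7 Sym² door);
KhareWintenberger2009 (the input); GelbartJacquet1978 (Sym² lift); arXiv:1412.1533 Conj. 1.2.3
(Hansen's occurrence conjecture, contains the target silently); arXiv:1609.06965 (Gee–Newton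
conditional big R = T); Thorne2016 (lifting with H¹(ad) ≠ 0, residually dihedral GL₂);
CalegariGeraghty2017; Calegari2023 §12 (rank-3 insoluble Artin is in the untouched 'fourth form').
DELTA: (i) Blichfeldt ⇒ insoluble primitive rank-3 Artin = PSL₂(𝔽_q)-representations, and at the
forced prime p | q the representation is residually Sym² f IN REGULAR WEIGHT for free (Tate lift +
KW + defining-characteristic Brauer reduction + Gelbart–Jacquet) — not in ADP, KW or Calegari's
survey; (ii) the diagnosis that t  [refs: 10.1215/s0012-9074-02-11235-6, 2605.03519, 2502.10799, math/0102233, 1412.1533, 1609.06965, doi:10.1215/s0012-9074-02-11235-6, KhareWintenberger2009, GelbartJacquet1978, Thorne2016, CalegariGeraghty2017, Calegari2023]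

Barriers (technique_class: completed-cohomology congruences automorphy-lifting): technique_class: completed-cohomology congruences automorphy-lifting
- Literature.Barriers.Langlands.NonRegularWeightBarrier: met at crux ArtinWeightLifting only (its
β-half): residual input and patching live in REGULAR weight (Sym² f, weights 0,k−1,2k−2), the
receptacle for σ is completed cohomology; the barrier's residue (classicality at weight (0,0,0)) is
named as the open half of the crux, not evaded — isolated.
- Literature.Barriers.Langlands.TaylorWilesNumericalCoincidence: met head-on — GL₃/ℚ has defect
defectGL 1 0 3 = 1; the line uses the barrier's listed evasion (positive-defect patching of
completed homology, CalegariGeraghty2017 / arXiv:1609.06965), nothing single-degree.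
- Literature.Barriers.Langlands.TaylorWilesNumericalCoincidenceNarrow: same; σ is not polarisable (3
≇ 3̄ up to twist), so the unitary escape is unavailable by construction and positive defect is
accepted.
- Literature.Barriers.Langlands.ResiduallyReducibleBarrier: ρ̄ = Ad⁰(ρ̄_f) is absolutely irreducible
(hypothesis of the crux), so the irreducibility/Mazur conjuncts of TaylorWilesImageHypotheses hold;
but the H¹-clause of adequacy FAILS at p = 7 for image PSL₂(7) — this is declared as the content of
crux (2)/α with the Thorne2016-type evasion (auxiliary Steinberg-type level) proposed, not hidden.
- Literature.Barriers.Langlands.PatchingLocalComponentBarrier: σ|Γ_{ℚ₇} (finite image, HT 0) and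
Sym² f need not lie on one potentially crystalline component; evaded only in the big-R = T_𝔪
formulation

History (route lifecycle, newest last):
- 2026-08-15T13:48:43Z · CLOSED retired — not-a-thesis: assembly does not conclude the sub-problem Statement (operator:999:1257524)

sub-problem: Langlands · status: closed(retired) · opened planner-plancard-Langlands-Langlands-psl2q-ar-094b763e-0 2026-08-15T11:00:14Z · rev 1 · ledger route-Langlands-PSL2ArtinDoor
GENERATED by the gate from the ledger (D-0016/17). Provers cite these decls: `theorem foo : Summit.Langlands.Langlands.Theses.PSL2ArtinDoor.<Decl> := …` in Summits/Langlands/Langlands/Theorems/<Name>.lean.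
-/

namespace Summit.Langlands.Langlands.Theses.PSL2ArtinDoor

open scoped BigOperators Topology Manifold Classical MeasureTheory ProbabilityTheory Matrix InnerProductSpace ComplexConjugate ContinuousMap
open Filter Set Function TopologicalSpace MeasureTheory

attribute [summit_statement] _root_.Langlands

/-- item stmt-Langlands-1994 · target · rank 0 · closed · moot by None · by planner
why it might fail: False only if strong Artin/(B) fails on GL₃/ℚ. As ROUTE target: modulo the known Door it is equivalent to the lone crux ArtinWeightLifting, reachable only by l₀=1 patching with non-adequate image at the forced p=7 (Ext¹_{SL₂(7)}(L(0),L(4))≠0) plus weight-(0,0,0) classicality; no such theorem yet.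
sources: Calegari2023, CalegariGeraghty2017, Thorne2012, Humphreys2005, KhareWintenberger2009, arXiv:math/0102233
[target] Strong Artin (almost-everywhere Satake form, the tree's IsPiOfArtinRep idiom of
StrongArtinGL2) for σ : Γ_ℚ → GL₃(ℂ) with image ≅ PSL₂(7) = GL₃(𝔽₂) (simple of order 168; such σ is
automatically irreducible with det 1) and complex conjugation non-trivial (⇔ the Klein field is not
totally real). Instance family of conjunct (B) GaloisToAutomorphic at n = 3, F = ℚ, HT (0,0,0).
General projective-Klein σ reduce to this by KleinTypeTwistReduction + TwistTransfer. Sources: card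
psl2q-artin-door-rank3; Calegari2023 §12. -/
@[route_item "route-Langlands-PSL2ArtinDoor"]
def KleinStrongArtin : Prop :=
  ∀ (σ : Literature.NumberTheory.GaloisRepresentations.FramedArtinRep ℚ 3), Nonempty (↥σ.toMonoidHom.range ≃* GL (Fin 3) (ZMod 2)) → (∃ c : Field.absoluteGaloisGroup ℚ, Literature.NumberTheory.GaloisRepresentations.IsComplexConjugation (Rat.castHom ℝ) c ∧ σ c ≠ 1) → ∃ (hcpt : Literature.NumberTheory.Automorphic.isCompact_glFiniteIntegralLevel 3 ℚ) (π : Literature.NumberTheory.Automorphic.CuspidalAutomorphicRepData 3 ℚ hcpt), Literature.NumberTheory.Automorphic.IsPiOfArtinRep σ π.1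

/-- item stmt-Langlands-1995 · crux · rank 2 · closed · moot by None · by planner
why it might fail: True iff (B) here, but may be unreachable: GL₃/ℚ has defect l₀=1; every positive-defect R=T (Calegari–Geraghty, Gee–Newton) is conditional AND needs adequate image, yet H¹(PSL₂(F₇),ad⁰ρ̄)⊇Ext¹(L(0),L(4))≠0 (Humphreys2005 §12.2; p=7<2(n+1)); no classicality at singular weight (0,0,0) beyond GL₂.
sources: CalegariGeraghty2017, GeeNewton2020, Thorne2012, Thorne2016, Humphreys2005, ClineParshallScott1975
[crux] AUTOMORPHY LIFTING AT ARTIN WEIGHT FROM THE Sym² RESIDUAL LOCUS (card cruxes α ∧ β in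
consequence form): if σ : Γ_ℚ → GL₃(ℂ) has image ≅ PSL₂(7) and SOME mod-7 reduction ρ̄ of σ (k alg.
closed of char 7, red : ℤ̄ → k, charpoly ρ̄(g) = red charpoly σ(g) ∀ g) is absolutely irreducible
and has charpoly ρ̄(Frob_q) = (X−1)(X² − (a_q²/(ε(q)q^{w−1}) − 2)X + 1) mod λ for a newform f ∈
S_w(Γ₁(N)), w ≥ 2, at all q ∤ 7N — i.e. ρ̄ ≅ Ad⁰(ρ̄_{f,λ}), residually = Sym² f ⊗ ω_f⁻¹, cuspidal
regular algebraic on GL₃ by GelbartJacquet_adjoint_lift — then σ is automorphic (∃ cuspidal π on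
GL₃(𝔸_ℚ) with IsPiOfArtinRep σ π). Intended split (tenure, after the completed-cohomology interface
lands): α big R_𝔪 = T_𝔪 for completed cohomology of GL₃/ℚ at 𝔪 = 𝔪(Sym² f), defect l₀ = 1, with
H¹(PSL₂(𝔽₇), ad⁰ Ad⁰) ≠ 0 (bad TW prime; Thorne2016-type auxiliary level at q ≡ 1 mod 7 with
ρ̄(Frob_q) of order 7); β: a de Rham HT-(0,0,0) point of Spf T_𝔪 is classical cuspidal with π_∞ of
Artin type. Sources: CalegariGeraghty2017; Gee–Newton arXiv:1609.06965; Hansen arXiv:1412.1533 Conj.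
1.2.3; Scholze2015; Thorne2016; Pan2022; arXiv:2605.03519. -/
@[route_item "route-Langlands-PSL2ArtinDoor"]
def ArtinWeightLifting : Prop :=
  ∀ (σ : Literature.NumberTheory.GaloisRepresentations.FramedArtinRep ℚ 3), Nonempty (↥σ.toMonoidHom.range ≃* GL (Fin 3) (ZMod 2)) → (∃ (k : Type) (_ : Field k) (_ : TopologicalSpace k) (_ : DiscreteTopology k) (_ : CharP k 7) (_ : IsAlgClosed k) (red : ↥(integralClosure ℤ ℂ) →+* k) (ρ : Literature.NumberTheory.GaloisRepresentations.ModPGaloisRep ℚ k 3), (∀ g : Field.absoluteGaloisGroup ℚ, ∃ P : Polynomial ↥(integralClosure ℤ ℂ), P.map (algebraMap ↥(integralClosure ℤ ℂ) ℂ) = Literature.NumberTheory.GaloisRepresentations.FramedRep.charpoly σ g ∧ Literature.NumberTheory.GaloisRepresentations.FramedRep.charpoly ρ g = P.map red) ∧ Literature.NumberTheory.GaloisRepresentations.FramedRep.IsAbsolutelyIrreducible ρ ∧ ∃ (N : ℕ) (_ : NeZero N) (w : ℕ) (f : CuspForm (CongruenceSubgroup.Gamma1 N) (w : ℤ)) (ιf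 : ↥(Literature.NumberTheory.EllipticCurves.ModularForms.coeffCharIntegers f) →+* k), 2 ≤ w ∧ Literature.NumberTheory.EllipticCurves.ModularForms.IsNewform1 f ∧ ∀ v : IsDedekindDomain.HeightOneSpectrum (NumberField.RingOfIntegers ℚ), ((Rat.HeightOneSpectrum.primesEquiv v : Nat.Primes) : ℕ) ∉ {q : ℕ | q ∣ N * 7} → Literature.NumberTheory.GaloisRepresentations.FramedGaloisRep.IsUnramifiedAt v ρ ∧ ∃ P : Polynomial ↥(Literature.NumberTheory.EllipticCurves.ModularForms.coeffCharIntegers f), P.map (algebraMap _ ↥(Literature.NumberTheory.EllipticCurves.ModularForms.coeffCharField f)) = Literature.NumberTheory.EllipticCurves.ModularForms.heckePolynomial f (Rat.HeightOneSpectrum.primesEquiv v : Nat.Primes) ∧ Literature.NumberTheory.GaloisRepresentations.FramedGaloisRep.HasFrobCharpolyAt v ((Polynomial.X - 1) * (Polynomial.X ^ 2 - Polynomial.C (((P.map ιf).coeff 1) ^ 2 * ((P.map ιf).coeff 0)⁻¹ - 2) * Polynomial.X + 1)) ρ) → ∃ (hcpt : Literature.NumberTheory.Automorphic.isCompact_glFiniteIntegralLevel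 3 ℚ) (π : Literature.NumberTheory.Automorphic.CuspidalAutomorphicRepData 3 ℚ hcpt), Literature.NumberTheory.Automorphic.IsPiOfArtinRep σ π.1

/-- item stmt-Langlands-1996 · support · rank 3 · closed · moot by None · by planner
why it might fail: Bookkeeping risks only: parity (c non-central ⇒ odd lift), the 7-modular Brauer identity deg-3 ↦ L(2), 2 ≤ Serre weight, and constructing LocalRestrictionAt 7 over ℚ₇ to USE the strong form of KW as vendored; Tate lifting is not yet a tree fact (cite item filed).
sources: SerreDurham1977, Bosman2011ProjectivePolynomials, KhareWintenberger2009, Humphreys2005, Serre1977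
[crux] THE RESIDUAL DOOR (theorem-sized modulo named facts): KW =
Literature.NumberTheory.Automorphic.khare_wintenberger (strong form, Serre weight/level); granted KW
at p = 7, every σ : Γ_ℚ → GL₃(ℂ) with image ≅ PSL₂(7) and σ(c) ≠ 1 has, over every algebraically
closed discrete k of characteristic 7, a mod-7 reduction ρ̄ (along some red : ℤ̄ → k) which is
absolutely irreducible and equals Ad⁰(ρ̄_f) for a newform f of weight w ≥ 2 and level N (charpoly
identity at all q ∤ 7N). Proof sketch: θ : im σ ≅ PSL₂(𝔽₇) ⊂ PGL₂(k); Tate-lift θ∘σ to σ̃ : Γ_ℚ →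
GL₂(k) with finite image (cite item: Serre, Durham 1977 §6); σ̃(c) is a non-scalar involution (c ≠ 1
in the centreless image) ⇒ conjugate to diag(1,−1) ⇒ σ̃ odd; σ̃ irreducible (projective image
PSL₂(7)); KW strong form ⇒ σ̃ ≅ ρ̄_{f,ι_f}, f ∈ S_{k(σ̃)}(Γ₁(N(σ̃))) newform, k(σ̃) ≥ 2
(two_le_serreWeightLocal_of_charZero; LocalRestrictionAt 7 built on ℚ₇ via
isNonarchimedeanLocalField_holds); 7-modular Brauer table of PSL₂(7) (cite item): irreducibles
L(0),L(2),L(4),L(6) of dims 1,3,5,7 and both complex degree-3 characters (3,−1,0,1 on classes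
1A,2A,3A,4A) reduce to the Brauer character of L(2) = Ad⁰ ⇒ ρ̄^ss ≅ Ad⁰(σ̃) (Brauer–Nesbitt on the -/
@[route_item "route-Langlands-PSL2ArtinDoor"]
def ResidualSymSquareDoor : Prop :=
  ∀ (k : Type) [Field k] [TopologicalSpace k] [DiscreteTopology k] [CharP k 7] [IsAlgClosed k] [Fact (Nat.Prime 7)], Literature.NumberTheory.Automorphic.khare_wintenberger 7 k → ∀ (σ : Literature.NumberTheory.GaloisRepresentations.FramedArtinRep ℚ 3), Nonempty (↥σ.toMonoidHom.range ≃* GL (Fin 3) (ZMod 2)) → (∃ c : Field.absoluteGaloisGroup ℚ, Literature.NumberTheory.GaloisRepresentations.IsComplexConjugation (Rat.castHom ℝ) c ∧ σ c ≠ 1) → ∃ (red : ↥(integralClosure ℤ ℂ) →+* k) (ρ : Literature.NumberTheory.GaloisRepresentations.ModPGaloisRep ℚ k 3), (∀ g : Field.absoluteGaloisGroup ℚ, ∃ P : Polynomial ↥(integralClosure ℤ ℂ), P.map (algebraMap ↥(integralClosure ℤ ℂ) ℂ) = Literature.NumberTheory.GaloisRepresentations.FramedRep.charpoly σ g ∧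 Literature.NumberTheory.GaloisRepresentations.FramedRep.charpoly ρ g = P.map red) ∧ Literature.NumberTheory.GaloisRepresentations.FramedRep.IsAbsolutelyIrreducible ρ ∧ ∃ (N : ℕ) (_ : NeZero N) (w : ℕ) (f : CuspForm (CongruenceSubgroup.Gamma1 N) (w : ℤ)) (ιf : ↥(Literature.NumberTheory.EllipticCurves.ModularForms.coeffCharIntegers f) →+* k), 2 ≤ w ∧ Literature.NumberTheory.EllipticCurves.ModularForms.IsNewform1 f ∧ ∀ v : IsDedekindDomain.HeightOneSpectrum (NumberField.RingOfIntegers ℚ), ((Rat.HeightOneSpectrum.primesEquiv v : Nat.Primes) : ℕ) ∉ {q : ℕ | q ∣ N * 7} → Literature.NumberTheory.GaloisRepresentations.FramedGaloisRep.IsUnramifiedAt v ρ ∧ ∃ P : Polynomial ↥(Literature.NumberTheory.EllipticCurves.ModularForms.coeffCharIntegers f), P.map (algebraMap _ ↥(Literature.NumberTheory.EllipticCurves.ModularForms.coeffCharField f)) = Literature.NumberTheory.EllipticCurves.ModularForms.heckePolynomial f (Rat.HeightOneSpectrum.primesEquiv v : Nat.Primes) ∧ Literature.NumberTheory.GaloisRepresentations.FramedGaloisRep.HasFrobCharpolyAt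 v ((Polynomial.X - 1) * (Polynomial.X ^ 2 - Polynomial.C (((P.map ιf).coeff 1) ^ 2 * ((P.map ιf).coeff 0)⁻¹ - 2) * Polynomial.X + 1)) ρ

/-- item stmt-Langlands-1997 · support · rank 9 · closed · moot by None · by planner
sources: SerreAbelianLadic1968, Serre1987
[support] Existence of mod-7 reductions of a rank-3 Artin representation over every algebraically
closed discrete k of characteristic 7: ∃ red : ℤ̄ → k and a continuous ρ̄ : Γ_ℚ → GL₃(k) with
charpoly ρ̄(g) = red(charpoly σ(g)) for all g. Proof: finite image (ArtinRep.finite_range_holds) ⇒ σ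
is conjugate into GL₃(O_{E,𝔭}) for a number field E and 𝔭 | 7 (StableLattice /
ResidualRepresentation.exists_integralModel over the DVR), reduce mod 𝔭 and embed O_E/𝔭 ↪ ℤ̄/𝔓 ↪ k;
continuity from the open kernel. Lemma toward ResidualSymSquareDoor. Sources: SerreAbelianLadic1968
I.1.1; Serre1987 §3. -/
@[route_item "route-Langlands-PSL2ArtinDoor"]
def ModSevenReductionExists : Prop :=
  ∀ (σ : Literature.NumberTheory.GaloisRepresentations.FramedArtinRep ℚ 3) (k : Type) [Field k] [TopologicalSpace k] [DiscreteTopology k] [CharP k 7] [IsAlgClosed k], ∃ (red : ↥(integralClosure ℤ ℂ) →+* k) (ρ : Literature.NumberTheory.GaloisRepresentations.ModPGaloisRep ℚ k 3), (∀ g : Field.absoluteGaloisGroup ℚ, ∃ P : Polynomial ↥(integralClosure ℤ ℂ), P.map (algebraMap ↥(integralClosure ℤ ℂ) ℂ) = Literature.NumberTheory.GaloisRepresentations.FramedRep.charpoly σ g ∧ Literature.NumberTheory.GaloisRepresentations.FramedRep.charpoly ρ g = P.map red)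

/-- item stmt-Langlands-1998 · support · rank 9 · closed · moot by None · by planner
sources: GetzHahn2024
[support] Every σ : Γ_ℚ → GL₃(ℂ) with PROJECTIVE image ≅ PSL₂(7) is a twist ψ ⊗ σ₀ with image(σ₀) ≅
PSL₂(7) and ψ a character: Γ = im σ, Γ̄ = Γ/(Γ ∩ Z) ≅ PSL₂(7); the derived group Γ' is a perfect
central extension of PSL₂(7) (so PSL₂(7) or SL₂(7)) with a faithful 3-dimensional representation,
impossible for SL₂(7) (faithful irreducibles have even degree 4,6,8; no 2-dimensional ones) ⇒ Γ' ≅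
PSL₂(7), Γ = (Γ ∩ Z) × Γ' (centreless), and the two projections give ψ and σ₀ (continuous: finite
image). Extends KleinStrongArtin to all Klein-type σ together with TwistTransfer. Sources: Atlas
(Conway et al. 1985) L₂(7) and 2.L₂(7) character degrees; GetzHahn2024 §13.4. -/
@[route_item "route-Langlands-PSL2ArtinDoor"]
def KleinTypeTwistReduction : Prop :=
  ∀ (σ : Literature.NumberTheory.GaloisRepresentations.FramedArtinRep ℚ 3), Nonempty (↥(Literature.NumberTheory.GaloisRepresentations.projectiveImage σ.toMonoidHom) ≃* GL (Fin 3) (ZMod 2)) → ∃ (σ₀ : Literature.NumberTheory.GaloisRepresentations.FramedArtinRep ℚ 3) (ψ : Literature.NumberTheory.GaloisRepresentations.FramedArtinRep ℚ 1), Nonempty (↥σ₀.toMonoidHom.range ≃* GL (Fin 3) (ZMod 2)) ∧ ∀ g : Field.absoluteGaloisGroup ℚ, ((σ g : GL (Fin 3) ℂ) : Matrix (Fin 3) (Fin 3) ℂ) = ((ψ g : GL (Fin 1) ℂ) : Matrix (Fin 1) (Fin 1) ℂ) 0 0 • ((σ₀ g : GL (Fin 3) ℂ) : Matrix (Fin 3)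 (Fin 3) ℂ)

/-- item stmt-Langlands-1999 · support · rank 9 · closed · moot by None · by planner
sources: Gelbart1997
[support] Automorphy passes along character twists: if σ = ψ ⊗ σ₀ (matrix identity) and σ₀ = π₀
almost everywhere, then σ = π₀ ⊗ (χ_ψ ∘ det) where χ_ψ is the Hecke character of ψ by global class
field theory over ℚ (tree: HeckeCharacterDictionary / GlobalReciprocity) and the twist is
CuspidalAutomorphicRepData.twist (AutomorphicTwistBJ), whose Satake parameters are χ_ψ(ϖ_v)·α. Glue
toward general Klein type. Sources: Gelbart1997 §2; BorelJacquet1979. -/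
@[route_item "route-Langlands-PSL2ArtinDoor"]
def TwistTransfer : Prop :=
  ∀ (σ σ₀ : Literature.NumberTheory.GaloisRepresentations.FramedArtinRep ℚ 3) (ψ : Literature.NumberTheory.GaloisRepresentations.FramedArtinRep ℚ 1), (∀ g : Field.absoluteGaloisGroup ℚ, ((σ g : GL (Fin 3) ℂ) : Matrix (Fin 3) (Fin 3) ℂ) = ((ψ g : GL (Fin 1) ℂ) : Matrix (Fin 1) (Fin 1) ℂ) 0 0 • ((σ₀ g : GL (Fin 3) ℂ) : Matrix (Fin 3) (Fin 3) ℂ)) → (∃ (hcpt : Literature.NumberTheory.Automorphic.isCompact_glFiniteIntegralLevel 3 ℚ) (π₀ : Literature.NumberTheory.Automorphic.CuspidalAutomorphicRepData 3 ℚ hcpt), Literature.NumberTheory.Automorphic.IsPiOfArtinRep σ₀ π₀.1) → ∃ (hcpt : Literature.NumberTheory.Automorphic.isCompact_glFiniteIntegralLevel 3 ℚ) (π : Literature.NumberTheory.Automorphic.CuspidalAutomorphicRepData 3 ℚ hcpt), Literature.NumberTheory.Automorphic.IsPiOfArtinRep σ π.1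

/-- item stmt-Langlands-2000 · support · rank 9 · closed · moot by None · by planner
sources: KhareWintenberger2009, Kisin2009
[support] THE p = 3 DOOR FOR THE VALENTINER GROUP (second simple primitive subgroup of PGL₃):
granted KW at p = 3, every σ : Γ_ℚ → GL₃(ℂ) with image of order 1080 and projective image ≅ A₆
(hence image ≅ 3.A₆ ⊂ SL₃(ℂ)) and σ(c) ≠ 1 has a mod-3 reduction ρ̄ which is absolutely irreducible
and equals Ad⁰(ρ̄_f) for a newform f of weight ≥ 2 (charpoly identity at q ∤ 3N). Mechanism: the
centre μ₃ dies mod (1−ζ₃), so ρ̄ factors through A₆ ≅ PSL₂(𝔽₉); the Brauer character of the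
Valentiner 3 on 3-regular classes (3,−1,1,−b₅,−b₅*) is that of L(2) or its Frobenius twist L(2)^(3)
= Ad⁰ of the natural SL₂(𝔽₉)-representation or of its Galois conjugate; Tate-lift Γ_ℚ → PSL₂(𝔽₉) ⊂
PGL₂(k) (either of the two Frobenius-conjugate embeddings), odd by the involution argument, KW at p
= 3 (Kisin). Entry point of the sibling Valentiner line; its lifting crux at p = 3 = n lies outside
Fontaine–Laffaille and every adequacy range and is NOT filed. Sources: KhareWintenberger2009;
Kisin2009; Atlas of Brauer Characters, 3.A₆ mod 3. -/
@[route_item "route-Langlands-PSL2ArtinDoor"]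
def ValentinerResidualDoor : Prop :=
  ∀ (k : Type) [Field k] [TopologicalSpace k] [DiscreteTopology k] [CharP k 3] [IsAlgClosed k] [Fact (Nat.Prime 3)], Literature.NumberTheory.Automorphic.khare_wintenberger 3 k → ∀ (σ : Literature.NumberTheory.GaloisRepresentations.FramedArtinRep ℚ 3), Nat.card ↥σ.toMonoidHom.range = 1080 → Nonempty (↥(Literature.NumberTheory.GaloisRepresentations.projectiveImage σ.toMonoidHom) ≃* alternatingGroup (Fin 6)) → (∃ c : Field.absoluteGaloisGroup ℚ, Literature.NumberTheory.GaloisRepresentations.IsComplexConjugation (Rat.castHom ℝ) c ∧ σ c ≠ 1) → ∃ (red : ↥(integralClosure ℤ ℂ) →+* k) (ρ : Literature.NumberTheory.GaloisRepresentations.ModPGaloisRep ℚ k 3), (∀ g : Field.absoluteGaloisGroup ℚ, ∃ P : Polynomial ↥(integralClosure ℤ ℂ), P.map (algebraMap ↥(integralClosure ℤ ℂ) ℂ) = Literature.NumberTheory.GaloisRepresentations.FramedRep.charpoly σ g ∧ Literature.NumberTheory.GaloisRepresentations.FramedRep.charpoly ρ g = P.map red) ∧ Literature.NumberTheory.GaloisRepresentations.FramedRep.IsAbsolutelyIrreducible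 ρ ∧ ∃ (N : ℕ) (_ : NeZero N) (w : ℕ) (f : CuspForm (CongruenceSubgroup.Gamma1 N) (w : ℤ)) (ιf : ↥(Literature.NumberTheory.EllipticCurves.ModularForms.coeffCharIntegers f) →+* k), 2 ≤ w ∧ Literature.NumberTheory.EllipticCurves.ModularForms.IsNewform1 f ∧ ∀ v : IsDedekindDomain.HeightOneSpectrum (NumberField.RingOfIntegers ℚ), ((Rat.HeightOneSpectrum.primesEquiv v : Nat.Primes) : ℕ) ∉ {q : ℕ | q ∣ N * 3} → Literature.NumberTheory.GaloisRepresentations.FramedGaloisRep.IsUnramifiedAt v ρ ∧ ∃ P : Polynomial ↥(Literature.NumberTheory.EllipticCurves.ModularForms.coeffCharIntegers f), P.map (algebraMap _ ↥(Literature.NumberTheory.EllipticCurves.ModularForms.coeffCharField f)) = Literature.NumberTheory.EllipticCurves.ModularForms.heckePolynomial f (Rat.HeightOneSpectrum.primesEquiv v : Nat.Primes) ∧ Literature.NumberTheory.GaloisRepresentations.FramedGaloisRep.HasFrobCharpolyAt v ((Polynomial.X - 1) * (Polynomial.X ^ 2 - Polynomial.C (((P.map ιf).coeff 1) ^ 2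 * ((P.map ιf).coeff 0)⁻¹ - 2) * Polynomial.X + 1)) ρ

-- item stmt-Langlands-2129 · support · rank 9 · closed · moot by None · by planner — informal only, no Lean statement yet:
--   [support] DIAGNOSIS (why crux ArtinWeightLifting cannot be an off-the-shelf R = T): at the forced
--   prime p = 7 the residual image of Ad⁰(ρ̄_f) restricted to G_{ℚ(ζ₇)} contains PSL₂(𝔽₇), and
--   H¹(PSL₂(𝔽₇), ad⁰ L(2)) ≠ 0, where L(2) = Ad⁰ of the natural SL₂(𝔽₇)-representation and ad⁰ L(2) ≅
--   L(4) ⊕ L(2) with H¹(SL₂(𝔽_p), L(p−3)) ≠ 0 (Cline–Parshall–Scott 1975; here L(4) = Sym⁴). Hence the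
--   H¹-clause of 'adequate' (Thorne2012 Def. 2.3) / 'enormous' (ACC+ arXiv:1812.09999 Def. 6.2.28) FAILS
--   for every Klein-image σ at its only usable prime, while H⁰(ad⁰) = 0, absolute irreducibility and the
--   spanning con

-- item stmt-Langlands-2173 · support · rank 9 · closed · moot by None · by planner — informal only, no Lean statement yet:
--   [support] DIAGNOSIS (why crux ArtinWeightLifting cannot be an off-the-shelf R = T): at the forced
--   prime p = 7 the residual image of Ad⁰(ρ̄_f) restricted to G_{ℚ(ζ₇)} contains PSL₂(𝔽₇), and
--   H¹(PSL₂(𝔽₇), ad⁰ L(2)) ≠ 0, where L(2) = Ad⁰ of the natural SL₂(𝔽₇)-representation and ad⁰ L(2) ≅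
--   L(4) ⊕ L(2) with H¹(SL₂(𝔽_p), L(p−3)) ≠ 0 (Cline–Parshall–Scott 1975; here L(4) = Sym⁴). Hence the
--   H¹-clause of 'adequate' (Thorne2012 Def. 2.3) / 'enormous' (ACC+ arXiv:1812.09999 Def. 6.2.28) FAILS
--   for every Klein-image σ at its only usable prime, while H⁰(ad⁰) = 0, absolute irreducibility and the
--   spanning con

/-- item stmt-Langlands-2001 · assembly · rank 1 · closed · moot by None · by planner
sources: KhareWintenberger2009
[assembly] KW₇ → ResidualSymSquareDoor → ArtinWeightLifting → KleinStrongArtin: modus ponens with k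
:= AlgebraicClosure (ZMod 7) carrying the discrete topology (proved as an `example` in the planner's
Sketch.lean, rc 0). KW₇ = the tree's named fact khare_wintenberger 7 k for all discrete fields k (a
theorem in print, KhareWintenberger2009 + Kisin2009), threaded as the first antecedent exactly as
RoyCriterion threads Roy2001_iff. -/
@[route_item "route-Langlands-PSL2ArtinDoor"]
def Assembly : Prop :=
  (∀ (k : Type) [Field k] [TopologicalSpace k] [DiscreteTopology k] [Fact (Nat.Prime 7)], Literature.NumberTheory.Automorphic.khare_wintenberger 7 k) → ResidualSymSquareDoor → ArtinWeightLifting → KleinStrongArtin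

end Summit.Langlands.Langlands.Theses.PSL2ArtinDoor
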